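import Summits.QuantumAdvantage.QuantumAdvantage.Theorems.LinnikCubicClassGroupsDegreeOnePrimesEscapeShortIntervalWindow
import HarnessLib

/-!
# Prime ideals of a class in short intervals, IV: the short-interval class prime number theorem for
# every number field of ODD degree (in particular every cubic field), unconditionally

Topic `Summits/QuantumAdvantage/QuantumAdvantage/Theorems`, cell B2b-1 (linnik-cubic), PART A (gen 5);
helper for the crux `DegreeOnePrimesEscape` (stmt-QuantumAdvantage-11543) of route
`LinnikCubicClassGroups`.  HONEST FRAMING: the value of this file is a THEOREM (kernel-checked, GRH-free,
Siegel-free) — NOT summit progress (the route still rests on the hypothesis-type target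
`PureCubicClassNumberHard`).

**Hoheisel–Linnik for ideal classes.**  For every ODD `n > 1` there are `δ = δ(n) > 0` and
`a₀ = a₀(n) > 0` such that for EVERY number field `K` of degree `n`, every ideal class `C ∈ Cl_K`, every
`x ≥ Q^{a₀}` (`Q = |d_K|·nⁿ`) and every `h` with `x^{1−δ} ≤ h ≤ x`:

  `h/(8 h_K) ≤ ψ_C(x + h) − ψ_C(x) ≤ 4 h/h_K`

(`classPsi_shortInterval_of_odd`; `ψ_C(y) = Σ_{N𝔞 ≤ y, [𝔞] = C} Λ(𝔞)`), and the case `n = 3`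
(`classPsi_shortInterval_cubic`: every cubic field, `Q = 27|d_K|`).  In words: the prime-power ideals
(and hence, up to `O(n√x log x)`, the prime ideals) of every ideal class are equidistributed in ALL short
intervals `(x, x + x^{1−δ}]` beyond `x ≥ |d_K|^{a₀}`, uniformly in the field — the first application of
the tree's log-free zero-density estimate WITH the `ζ_K` pole term (`logFreeDensity_dedekindZeta₁_all`,
PART A of this cell) beyond Linnik's theorem: Hoheisel's mechanism needs the density estimate at height
`T = X^θ`, a power of `x`, where no classical (`T`-logarithmic) estimate suffices.

Proof (`window_error_le`): the explicit formulae of the family against the window weight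
`windowTest lo hi (η/4)` (`η = log(1 + h/x)`; files I–III), the flat zero sum by Bombieri's partial
summation at height `T₁ = X^θ` against `fam_density_local` (X1 + X2 + the residue bound
`Residue.residueLowerBound_all`, every field), the zero-free region off the exceptional segment
(`exists_exceptionalZero_const`), NO exceptional zero in odd degree (`not_excRegion_of_odd`), and the
absorption of all secondary terms (`absorb_junk`); then unsmoothing by monotonicity with the two windows
`[log x, log(x+h)] ⊂` plateau (upper) and plateau `⊂ (log x, log(x+h))` (lower).

## References

* G. Hoheisel, *Primzahlprobleme in der Analysis*, S.-B. Preuss. Akad. Wiss. (1930) 580–588.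
* A. Balog, K. Ono, *The Chebotarev density theorem in short intervals and some questions of Serre*,
  J. Number Theory 91 (2001) 356–371 (per-field short-interval Chebotarev; constants depend on the field).
* J. Thorner, A. Zaman, *A unified and improved Chebotarev density theorem*, ANT 13 (2019). [ThornerZaman2019]
* A. Weiss, *The least prime ideal*, J. reine angew. Math. 338 (1983). [Weiss1983]
-/

noncomputable section

open Complex Real MeasureTheory Set Filter Topology
open scoped NumberField nonZeroDivisors

namespace Summit.QuantumAdvantage.QuantumAdvantage.Theorems.DegreeOnePrimesEscape

open Literature.NumberTheory.LFunctions Literature.NumberTheory.LFunctions.NumberField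
  Literature.NumberTheory.LFunctions.EntireEF Literature.NumberTheory.LFunctions.WindowWeight
  Literature.NumberTheory.LFunctions.AbelianDensity

/-! ### The short-interval class prime number theorem in odd degree -/

set_option maxHeartbeats 1600000 in
/-- **Hoheisel–Linnik for ideal classes, every number field of ODD degree, unconditionally.**  For odd
`n > 1` there are `δ, a₀ > 0` such that for EVERY number field `K` of degree `n`, every ideal class `C`,
every `x ≥ Q^{a₀}` (`Q = |d_K|·nⁿ`) and every `h` with `x^{1−δ} ≤ h ≤ x`:
`h/(8 h_K) ≤ ψ_C(x + h) − ψ_C(x) ≤ 4h/h_K`.  GRH-free and Siegel-free; the inputs are the tree's log-free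
zero-density estimates for the class group `L`-functions AND for `ζ_K` with its pole term (PART A of cell
B2b-1), the Landau–Page package, Stark's odd-degree exclusion of exceptional zeros, and the residue lower
bound for every field. -/
theorem classPsi_shortInterval_of_odd (n : ℕ) (hn : 1 < n) (hodd : Odd n) :
    ∃ δ a₀ : ℝ, 0 < δ ∧ 0 < a₀ ∧ ∀ (K : Type) [Field K] [NumberField K], Module.finrank ℚ K = n →
      ∀ (C : ClassGroup (𝓞 K)) (x h : ℝ), ThornerZaman.condQn K ^ a₀ ≤ x → x ^ (1 - δ) ≤ h → h ≤ x →
        h / (8 * (NumberField.classNumber K : ℝ)) ≤ classPsi K C (x + h) - classPsi K C x ∧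
          classPsi K C (x + h) - classPsi K C x ≤ 4 * h / (NumberField.classNumber K : ℝ) := by
  classical
  obtain ⟨A, -, hA⟩ := Residue.residueLowerBound_all n
  obtain ⟨b, D, hb, hD, hdensAll⟩ := fam_density_local n hn A
  obtain ⟨c₀, hc₀, hpackAll⟩ := exists_exceptionalZero_const n
  obtain ⟨M, hM1, hM⟩ := TZWeight.exists_smoothTransition_deriv_bound
  obtain ⟨A_L, hAL, hAbd⟩ := exists_norm_logDeriv_classGroupLFunction_left_le
  obtain ⟨hc₁16, hc₂0⟩ := tailConst_nonneg
  have hlC := leftLineConst_nonneg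
  have ha4 : (4 : ℝ) ≤ max A 4 := le_max_right _ _
  have ha1 : (1 : ℝ) ≤ max A 4 := by linarith
  set c : ℝ := min c₀ (1 / (8 * ((2 * n).factorial : ℝ))) with hc_def
  have hc : 0 < c := lt_min hc₀ (by positivity)
  have hcc₀ : c ≤ c₀ := min_le_left _ _
  have hc8 : c ≤ 1 / (8 * ((2 * n).factorial : ℝ)) := min_le_right _ _
  -- the exponent `θ`
  set Λ : ℝ := Real.log (128 * Real.exp 1 * D + 3) with hΛ
  have hΛarg : 1 < 128 * Real.exp 1 * D + 3 := by
    have : 0 < 128 * Real.exp 1 * D := by positivity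
    linarith
  have hΛ0 : 0 < Λ := Real.log_pos hΛarg
  set θ : ℝ := min (1 / (8 * b)) (min (1 / 8) (c / (6 * Λ))) with hθ
  have hθ0 : 0 < θ := by positivity
  have hθb : θ * b ≤ 1 / 8 := by
    have h1 : θ ≤ 1 / (8 * b) := min_le_left _ _
    calc θ * b ≤ 1 / (8 * b) * b := mul_le_mul_of_nonneg_right h1 hb.le
      _ = 1 / 8 := by field_simp
  have hθ1 : θ ≤ 1 / 8 := (min_le_right _ _).trans (min_le_left _ _)
  have hθΛ : θ ≤ c / (6 * Λ) := (min_le_right _ _).trans (min_le_right _ _)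
  have hθflat : 2 * Real.exp 1 * D * Real.exp (-(c / (6 * θ))) ≤ 1 / 64 := by
    have h1 : Λ ≤ c / (6 * θ) := by
      rw [le_div_iff₀ (by positivity)]
      have := (le_div_iff₀ (by positivity : (0 : ℝ) < 6 * Λ)).1 hθΛ
      linarith
    have h2 : Real.exp (-(c / (6 * θ))) ≤ Real.exp (-Λ) := Real.exp_le_exp.2 (by linarith)
    have h3 : Real.exp (-Λ) = (128 * Real.exp 1 * D + 3)⁻¹ := by
      rw [hΛ, Real.exp_neg, Real.exp_log (by linarith)]
    have h4 : 2 * Real.exp 1 * D * (128 * Real.exp 1 * D + 3)⁻¹ ≤ 1 / 64 := by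
      rw [← div_eq_mul_inv, div_le_div_iff₀ (by linarith) (by norm_num)]
      linarith
    calc 2 * Real.exp 1 * D * Real.exp (-(c / (6 * θ))) ≤ 2 * Real.exp 1 * D * Real.exp (-Λ) :=
          mul_le_mul_of_nonneg_left h2 (by positivity)
      _ ≤ 1 / 64 := by rw [h3]; exact h4
  -- the absorption constant and the threshold `a₀`
  set CJ : ℝ := 338 * (512 * ((n : ℝ) + 1)) + 96 * M * (512 * ((n : ℝ) + 1)) * (4 * tailConst₁ + tailConst₂) +
    108 + 640 * leftLineConst * A_L * M with hCJ
  have hM0 : 0 ≤ M := by linarith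
  have hc₁0 : 0 ≤ tailConst₁ := by linarith
  have hCJ0 : 0 ≤ CJ := by rw [hCJ]; positivity
  obtain ⟨a₁, ha₁1, habsAll⟩ := absorb_junk (32 * CJ) θ (by positivity) hθ0 (by linarith)
  set a₀ : ℝ := max a₁ (max A 4 / θ) with ha₀
  have ha₀1 : 1 ≤ a₀ := ha₁1.trans (le_max_left _ _)
  refine ⟨θ / 8, a₀, by positivity, by linarith, fun K _ _ hKn C x h hx hhx hhx' ↦ ?_⟩
  -- the field
  have hK : 1 < Module.finrank ℚ K := by rw [hKn]; exact hn
  set Q : ℝ := ThornerZaman.condQn K with hQ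
  have hQ12 : (12 : ℝ) ≤ Q := ThornerZaman.twelve_le_condQn (K := K) hK
  have hQ1 : (1 : ℝ) < Q := by linarith
  obtain ⟨-, -, hlog12⟩ := log_small_consts
  have hlogQ : 2 ≤ Real.log Q := hlog12.trans (Real.log_le_log (by norm_num) hQ12)
  have hxa₁ : Q ^ a₁ ≤ x := (Real.rpow_le_rpow_of_exponent_le hQ1.le (le_max_left _ _)).trans hx
  have hxaθ : Q ^ (max A 4 / θ) ≤ x := (Real.rpow_le_rpow_of_exponent_le hQ1.le (le_max_right _ _)).trans hx
  have hQx : Q ≤ x := by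
    have := (Real.rpow_le_rpow_of_exponent_le hQ1.le ha₀1).trans hx
    rwa [Real.rpow_one] at this
  have hx1 : 1 < x := by linarith
  have hx0 : 0 < x := by linarith
  set L : ℝ := Real.log x with hL
  have hL0 : 0 < L := Real.log_pos hx1
  have haθ : max A 4 * Real.log Q ≤ θ * L := by
    have h1 := Real.log_le_log (by positivity) hxaθ
    rw [Real.log_rpow (by linarith), ← hL] at h1
    have h2 : θ * (max A 4 / θ * Real.log Q) = max A 4 * Real.log Q := by field_simp
    have h3 := mul_le_mul_of_nonneg_left h1 hθ0.le
    linarith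
  have h2θ : 2 ≤ θ * L := by
    have := mul_le_mul ha4 hlogQ (by norm_num) (le_trans (by norm_num) ha4)
    linarith
  -- `h`, `t = h/x` and `η = log(1 + t)`
  have hδpos : 0 < x ^ (1 - θ / 8) := Real.rpow_pos_of_pos hx0 _
  have hh0 : 0 < h := lt_of_lt_of_le hδpos hhx
  set t : ℝ := h / x with ht
  have ht0 : 0 < t := by positivity
  have ht1 : t ≤ 1 := by rw [ht, div_le_one hx0]; exact hhx'
  have hxt : x * t = h := by rw [ht]; field_simp
  have hxh : x + h = x * (1 + t) := by rw [mul_add, mul_one, hxt]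
  set η : ℝ := Real.log (1 + t) with hη
  have hη0 : 0 < η := Real.log_pos (by linarith)
  have hη1 : η ≤ Real.log 2 := Real.log_le_log (by linarith) (by linarith)
  have hηt : t / 2 ≤ η := by
    have h1 := Real.one_sub_inv_le_log_of_pos (show (0 : ℝ) < 1 + t by linarith)
    have h2 : t / 2 ≤ 1 - (1 + t)⁻¹ := by
      rw [show 1 - (1 + t)⁻¹ = t / (1 + t) by field_simp; ring]
      exact div_le_div_of_nonneg_left ht0.le (by linarith) (by linarith)
    linarith
  have hηt' : η ≤ t := by
    have := Real.log_le_sub_one_of_pos (show (0 : ℝ) < 1 + t by linarith); rw [hη]; linarith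
  have hlogxh : Real.log (x + h) = L + η := by
    rw [hxh, Real.log_mul hx0.ne' (by linarith), hL, hη]
  have hηx : Real.exp (-(θ / 8) * Real.log x) ≤ 2 * η := by
    -- `x^{−θ/8} = x^{1−θ/8}/x ≤ h/x = t ≤ 2η`
    have h1 : Real.exp (-(θ / 8) * Real.log x) = x ^ (1 - θ / 8) / x := by
      rw [Real.rpow_def_of_pos hx0, eq_div_iff hx0.ne', ← Real.exp_log hx0, ← Real.exp_add, Real.exp_log hx0]
      congr 1; ring
    rw [h1]
    have h2 : x ^ (1 - θ / 8) / x ≤ h / x := div_le_div_of_nonneg_right hhx hx0.le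
    linarith
  have habs : (338 * (512 * ((n : ℝ) + 1)) + 96 * M * (512 * ((n : ℝ) + 1)) * (4 * tailConst₁ + tailConst₂) + 108 +
      640 * leftLineConst * A_L * M) * ThornerZaman.condQn K ^ (7 : ℕ) * (Real.log x + 1) *
      Real.exp (-(θ / 4) * Real.log x) ≤ 1 / 32 := by
    have h1 := habsAll Q x hQ12 hxa₁
    rw [Real.rpow_def_of_pos hx0, show Real.log x * (-(θ / 4)) = -(θ / 4) * Real.log x by ring] at h1
    rw [← hCJ, ← hQ]
    have h2 : CJ * Q ^ (7 : ℕ) * (Real.log x + 1) * Real.exp (-(θ / 4) * Real.log x) =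
        (32 * CJ * Q ^ (7 : ℕ) * (Real.log x + 1) * Real.exp (-(θ / 4) * Real.log x)) / 32 := by ring
    rw [h2, div_le_div_iff₀ (by norm_num) (by norm_num)]
    linarith
  -- the analytic hypotheses for `K`
  have hdens := hdensAll K hKn (hA K hKn)
  obtain ⟨hLPreal, -, -⟩ := hpackAll K hKn
  have hpack := pack_of_le (K := K) hcc₀ hLPreal
  have hnoexc : ∀ (ψ : AddChar (Additive (ClassGroup (𝓞 K))) ℂ) (ρ : ℂ), famF K ψ ρ = 0 → 0 < ρ.re →
      ρ.re < 1 → ¬ excRegion c K ρ :=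
    fun ψ ρ h0 _ hρ1 ↦ not_excRegion_of_odd (by rw [hKn]; exact hodd) hK hc (by rw [hKn]; exact hc8) hpack ψ h0 hρ1
  -- the error of the two windows
  have herr : ∀ {lo hi : ℝ}, L ≤ lo → lo < hi → hi ≤ L + η → ∀ C' : ClassGroup (𝓞 K),
      |(NumberField.classNumber K : ℝ) * smoothedPsiClass K C' (windowTest lo hi (η / 4)) -
        (fordLaplace (windowTest lo hi (η / 4)) (-1)).re| ≤ x * η / 8 :=
    fun hlo hlohi hhi C' ↦ window_error_le hn hKn hb hD ha1 hdens hc hpack hnoexc hM1 hM hAL hAbd hθ0 hθb hθ1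
      hθflat hQx haθ h2θ hη0 hη1 hηx habs hlo hlohi hhi C'
  -- sizes
  have hL16 : 16 ≤ L := by
    have := mul_le_mul_of_nonneg_right hθ1 hL0.le; linarith
  have hε0 : 0 < η / 4 := by positivity
  have hlog2 : Real.log 2 < 0.6931471808 := Real.log_two_lt_d9
  have hη07 : η < 0.7 := by linarith
  set hK' : ℝ := (NumberField.classNumber K : ℝ) with hhK'
  have hh1 : 1 ≤ hK' := by rw [hhK']; exact_mod_cast one_le_classNumber (K := K)
  have hhKpos : 0 < hK' := by linarith
  have hxexp : Real.exp L = x := by rw [hL, Real.exp_log hx0]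
  have hxη : x * η ≤ h := by
    have := mul_le_mul_of_nonneg_left hηt' hx0.le; rw [hxt] at this; exact this
  have hxη' : h ≤ 2 * (x * η) := by
    have := mul_le_mul_of_nonneg_left hηt hx0.le; rw [← hxt]; linarith
  constructor
  · -- LOWER bound with the window `[L + η/4, L + 3η/4]` (support `(L, L + η)`)
    have hlo : L ≤ L + η / 4 := by linarith
    have hlohi : L + η / 4 < L + 3 * η / 4 := by linarith
    have hhi : L + 3 * η / 4 ≤ L + η := by linarith
    have he := herr hlo hlohi hhi C
    set g := windowTest (L + η / 4) (L + 3 * η / 4) (η / 4) with hg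
    -- unsmoothing
    have hle : smoothedPsiClass K C g ≤ classPsi K C (x + h) - classPsi K C x := by
      refine smoothedPsiClass_le_classPsi_sub C hx1.le hh0.le (fun u ↦ windowTest_mem_Icc _ _ _ u)
        (fun u hu ↦ windowTest_eq_zero_of_le hε0 ?_) (fun u hu ↦ ?_)
      · have hu' : u ≤ L := hu
        linarith
      · refine windowTest_eq_zero_of_ge hε0 ?_
        have hu' : Real.log (x + h) ≤ u := hu
        rw [hlogxh] at hu'; linarith
    -- main term `Re F(−1) ≥ x (e^{3η/4} − e^{η/4}) ≥ x η/2`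
    have hmain := (fordLaplace_windowTest_neg_one_mem (a := L + η / 4) (b := L + 3 * η / 4) hε0
      (by linarith) hlohi.le).1
    have hmt : x * η / 2 ≤ Real.exp (L + 3 * η / 4) - Real.exp (L + η / 4) := by
      rw [Real.exp_add, Real.exp_add, hxexp, ← mul_sub]
      have := mul_le_mul_of_nonneg_left (half_eta_le_exp_sub hη0.le) hx0.le
      linarith
    -- combine
    have hlow : x * η / 2 - x * η / 8 ≤ hK' * smoothedPsiClass K C g := by
      have := (abs_le.1 he).1
      linarith
    have h3 : 3 * (x * η) / 8 / hK' ≤ smoothedPsiClass K C g := by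
      rw [div_le_iff₀ hhKpos]; linarith
    calc h / (8 * hK') ≤ 3 * (x * η) / 8 / hK' := by
          rw [div_div, div_le_div_iff₀ (by positivity) (by positivity)]
          exact mul_le_mul_of_nonneg_right (by linarith) (by positivity)
      _ ≤ smoothedPsiClass K C g := h3
      _ ≤ classPsi K C (x + h) - classPsi K C x := hle
  · -- UPPER bound with the window `[L, L + η]` (plateau `⊇ [log x, log(x+h)]`)
    have hlo : L ≤ L := le_rfl
    have hlohi : L < L + η := by linarith
    have hhi : L + η ≤ L + η := le_rfl
    have he := herr hlo hlohi hhi C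
    set g := windowTest L (L + η) (η / 4) with hg
    have hle : classPsi K C (x + h) - classPsi K C x ≤ smoothedPsiClass K C g := by
      refine classPsi_sub_le_smoothedPsiClass C (x₀ := L + η + η / 4) hx1.le hh0.le
        (fun u ↦ windowTest_nonneg _ _ _ u) (fun u hu1 hu2 ↦ ?_) (fun u hu ↦ windowTest_eq_zero_of_ge hε0 hu)
      have hu1' : L < u := hu1
      have hu2' : u ≤ Real.log (x + h) := hu2
      rw [hlogxh] at hu2'
      exact windowTest_eq_one hε0 hu1'.le hu2'
    -- main term `Re F(−1) ≤ x (e^{5η/4} − e^{−η/4}) ≤ (15/4) x η`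
    have hmain := (fordLaplace_windowTest_neg_one_mem (a := L) (b := L + η) hε0 (by linarith) hlohi.le).2
    have hmt : Real.exp (L + η + η / 4) - Real.exp (L - η / 4) ≤ 15 / 4 * (x * η) := by
      have h1 : Real.exp (L + η + η / 4) = x * Real.exp (5 * η / 4) := by
        rw [show L + η + η / 4 = L + 5 * η / 4 by ring, Real.exp_add, hxexp]
      have h2 : Real.exp (L - η / 4) = x * Real.exp (-(η / 4)) := by
        rw [show L - η / 4 = L + -(η / 4) by ring, Real.exp_add, hxexp]
      rw [h1, h2, ← mul_sub]
      have := mul_le_mul_of_nonneg_left (exp_sub_exp_le_eta hη0.le hη07.le) hx0.le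
      linarith
    have hup : hK' * smoothedPsiClass K C g ≤ 15 / 4 * (x * η) + x * η / 8 := by
      have := (abs_le.1 he).2
      linarith
    calc classPsi K C (x + h) - classPsi K C x ≤ smoothedPsiClass K C g := hle
      _ ≤ (15 / 4 * (x * η) + x * η / 8) / hK' := by rw [le_div_iff₀ hhKpos]; linarith
      _ ≤ 4 * h / hK' := by
          refine div_le_div_of_nonneg_right ?_ hhKpos.le
          linarith

/-- **Every CUBIC field: prime-power ideals of every ideal class in every short interval**
(`Q = 27|d_K|`): there are absolute `δ, a₀ > 0` with `h/(8h_K) ≤ ψ_C(x+h) − ψ_C(x) ≤ 4h/h_K` for every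
cubic field `K`, every class `C`, every `x ≥ Q^{a₀}` and `x^{1−δ} ≤ h ≤ x` — the `n = 3` slice of the cell. -/
theorem classPsi_shortInterval_cubic :
    ∃ δ a₀ : ℝ, 0 < δ ∧ 0 < a₀ ∧ ∀ (K : Type) [Field K] [NumberField K], Module.finrank ℚ K = 3 →
      ∀ (C : ClassGroup (𝓞 K)) (x h : ℝ), ThornerZaman.condQn K ^ a₀ ≤ x → x ^ (1 - δ) ≤ h → h ≤ x →
        h / (8 * (NumberField.classNumber K : ℝ)) ≤ classPsi K C (x + h) - classPsi K C x ∧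
          classPsi K C (x + h) - classPsi K C x ≤ 4 * h / (NumberField.classNumber K : ℝ) :=
  classPsi_shortInterval_of_odd 3 (by norm_num) (by decide)

end Summit.QuantumAdvantage.QuantumAdvantage.Theorems.DegreeOnePrimesEscape

end
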